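import Summits.NavierStokesRegularity.NavierStokesRegularity.Theses.AxisymmetricExtremality
import Summits.NavierStokesRegularity.NavierStokesRegularity.Theorems.AxisymmetricExtremalityAxisymmetricKatoGlobalNoSwirlStratum
import Literature.Analysis.FluidPDE.AxisymmetricReflection
import HarnessLib

/-!
# Strategist census `s12-g7` (family `s`, independent) — crux `AxisymmetricKatoGlobal`
(item stmt-NavierStokesRegularity-15453, route AxisymmetricExtremality)

Scratch file of the crux-strategist seat `cstrat-stmt-NavierStokesRegularity-15453-s12-g7`
(census `STRATEGY-CENSUS-s12-g7.md`).  Everything here ELABORATES; the only unproved objects are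
`def … : Prop` signatures (open statements are never asserted).  Contents:

* §1 WEAKER INTERMEDIATE.  The deciding theorem `closes` of the route consumes only the
  THRESHOLD INSTANCE of the crux: `NoAxisymmetricMinimalDatum` («no axisymmetric Rusin–Šverák
  minimal blow-up datum»).  `closes_of_noAxisymmetricMinimalDatum` re-glues the route with it
  (pure logic), `noAxisymmetricMinimalDatum_of_crux` is the trivial direction.
* §2 DECOMPOSITION ATTEMPT «mirror extremality one level down» (the NLS "minimal blow-up is
  symmetric" transfer, inside the axisymmetric class): S1 `AxisymMinimalBlowupExists`
  (Rusin–Šverák run inside the closed invariant axisymmetric class — known method), S2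
  `AxisymMinimalMirrorSymmetric` (a minimal axisymmetric blow-up datum equivariant under the
  meridian mirror `σ = reflY` exists — the bet).  Composition `crux_of_mirrorExtremality :
  S1 → S2 → AxisymmetricKatoGlobal` is kernel-checked (σ-fixed axisymmetric fields are swirl-free,
  `IsAxisymmetric.hasNoSwirl_of_reflY_eq`; swirl-free axisymmetric `L³` data are Kato-global for
  every `ν`, `NoSwirlStratum.hasGlobalKatoSolution_of_isAxisymmetric_hasNoSwirl_viscosity` — both
  LANDED).  COSTUME CERTIFICATE: `mirrorExtremality_iff_crux : S1 → (S2 ↔ crux)` — the piece S2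
  is the whole crux (the mirror acts on the axisymmetric minimal class by swirl reversal
  `Γ ↦ −Γ`, freely, because its fixed points are swirl-free hence global).
* §3 THE PARENT LEVER PUSHED TO 2-GROUPS.  `MinimalDatumDihedral` (the `F₂`-Smith output:
  minimal data equivariant under the dihedral 2-groups `⟨R_{2π/p}, σ⟩`, unboundedly many `p`) and
  the compactness upgrade `DihedralToMirrorAxisymmetric` (provable like the landed
  `PFoldToAxisymmetric`) decide the summit WITHOUT the crux (`closes_dihedral`), and
  `minimalDatumDihedral_iff_summit : DihedralToMirrorAxisymmetric → (MinimalDatumDihedral ↔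
  NavierStokesRegularity)`: any symmetry demand containing a meridian mirror turns the Smith
  crux into the summit itself.  Hence chiral (`SO(2)`) symmetry is the most the lever can ask
  for, and the crux AX_H is irreducible in this route.
-/

noncomputable section

-- single-conjunct summit: `Summit.<Summit>.<Problem>` repeats the name by the D-0017 layout
set_option linter.dupNamespace false

open MeasureTheory Set Function
open scoped ENNReal
open Literature.Analysis Literature.Analysis.FluidPDE
open Summit.NavierStokesRegularity.NavierStokesRegularity.Theses.AxisymmetricExtremality
  (MinimalDatumPFold PFoldToAxisymmetric AxisymmetricKatoGlobal)

namespace Summit.NavierStokesRegularity.NavierStokesRegularity.Cruxes.AxisymmetricKatoGlobal.StrategistS12g7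

/-! ## §1 The weaker intermediate actually consumed by `closes` -/

/-- **AXmin** — the threshold instance of the crux: there is no axisymmetric Rusin–Šverák minimal
blow-up datum (for any viscosity).  Formally weaker than `AxisymmetricKatoGlobal`
(`noAxisymmetricMinimalDatum_of_crux`); sufficient for the route (`closes_of_noAxisymmetricMinimalDatum`). -/
def NoAxisymmetricMinimalDatum : Prop :=
  ∀ ν : ℝ, 0 < ν → ∀ (u₀ : EuclideanSpace ℝ (Fin 3) → EuclideanSpace ℝ (Fin 3))
    (g : FunctionSpaces.HomSobolev (EuclideanSpace ℝ (Fin 3)) (EuclideanSpace ℂ (Fin 3)) (1 / 2 : ℝ)),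
    IsMinimalBlowupDatum ν u₀ g → IsAxisymmetric u₀ → False

/-- The crux implies its threshold instance (unfold the minimality clause `¬ HasGlobalKatoSolution`). -/
theorem noAxisymmetricMinimalDatum_of_crux (h : AxisymmetricKatoGlobal) :
    NoAxisymmetricMinimalDatum := by
  intro ν hν u₀ g hmin hax
  obtain ⟨hL3, hrep, hdiv, -, hnot⟩ := hmin
  exact hnot (h ν hν u₀ g hL3 hrep hdiv (fun θ x => hax θ x))

/-- **Re-glued deciding theorem**: the route closes from `MinimalDatumPFold`, the landed
`PFoldToAxisymmetric` and the THRESHOLD INSTANCE alone (same pure-logic proof as `closes`). -/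
theorem closes_of_noAxisymmetricMinimalDatum (h₂ : MinimalDatumPFold) (h₄ : PFoldToAxisymmetric)
    (h₃ : NoAxisymmetricMinimalDatum) : NavierStokesRegularity := by
  show Literature.NS.NavierStokesExistenceSmoothR3
  intro ν hν u₀ hsm hdiv hdec
  by_contra hno
  obtain ⟨u₁, g, hmin, hax⟩ := h₄ ν hν (h₂ ν hν ⟨u₀, hsm, hdiv, hdec, hno⟩)
  exact h₃ ν hν u₁ g hmin (fun θ x => hax θ x)

/-! ## §2 Decomposition attempt: mirror extremality inside the axisymmetric class -/

/-- The Rusin–Šverák threshold WITHIN the axisymmetric class,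
`ρ_ax(ν) = sup {ρ | every axisymmetric weakly div-free u₀ ∈ L³ represented by g ∈ Ḣ^{1/2} with
‖g‖ < ρ has a global Kato solution}` (so `ρ_max^pure(ν) ≤ ρ_ax(ν)`; the crux says `ρ_ax = ⊤`). -/
def axisymThreshold (ν : ℝ) : ℝ≥0∞ :=
  sSup {ρ : ℝ≥0∞ | ∀ (u₀ : EuclideanSpace ℝ (Fin 3) → EuclideanSpace ℝ (Fin 3))
    (g : FunctionSpaces.HomSobolev (EuclideanSpace ℝ (Fin 3)) (EuclideanSpace ℂ (Fin 3)) (1 / 2 : ℝ)),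
    MemLp u₀ 3 → g.Represents (FunctionSpaces.EuclideanSpace.complexify ∘ u₀) → IsWeaklyDivFree u₀ →
    IsAxisymmetric u₀ → ‖g‖ₑ < ρ → HasGlobalKatoSolution ν u₀}

/-- A minimal blow-up datum OF THE AXISYMMETRIC CLASS: axisymmetric, at the axisymmetric
threshold, without a global Kato solution. -/
def IsAxisymMinimalBlowupDatum (ν : ℝ) (u₀ : EuclideanSpace ℝ (Fin 3) → EuclideanSpace ℝ (Fin 3))
    (g : FunctionSpaces.HomSobolev (EuclideanSpace ℝ (Fin 3)) (EuclideanSpace ℂ (Fin 3)) (1 / 2 : ℝ)) : Prop :=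
  MemLp u₀ 3 ∧ g.Represents (FunctionSpaces.EuclideanSpace.complexify ∘ u₀) ∧ IsWeaklyDivFree u₀ ∧
    IsAxisymmetric u₀ ∧ ‖g‖ₑ = axisymThreshold ν ∧ ¬ HasGlobalKatoSolution ν u₀

/-- An axisymmetric datum without a global Kato solution bounds the axisymmetric threshold. -/
theorem axisymThreshold_le {ν : ℝ} {u₀ : EuclideanSpace ℝ (Fin 3) → EuclideanSpace ℝ (Fin 3)}
    {g : FunctionSpaces.HomSobolev (EuclideanSpace ℝ (Fin 3)) (EuclideanSpace ℂ (Fin 3)) (1 / 2 : ℝ)}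
    (hL3 : MemLp u₀ 3) (hrep : g.Represents (FunctionSpaces.EuclideanSpace.complexify ∘ u₀))
    (hdiv : IsWeaklyDivFree u₀) (hax : IsAxisymmetric u₀) (hnot : ¬ HasGlobalKatoSolution ν u₀) :
    axisymThreshold ν ≤ ‖g‖ₑ := by
  refine sSup_le fun ρ hρ => ?_
  by_contra hlt
  exact hnot (hρ u₀ g hL3 hrep hdiv hax (lt_of_not_ge hlt))

/-- **S1** (Rusin–Šverák 2011, Thm. 1.1 / Cor. 4.3, run inside the closed, flow-invariant,
scaling- and axial-translation-invariant axisymmetric class; singular points of axisymmetric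
suitable solutions lie on the axis, so the recentring translations are axial): if the
axisymmetric threshold is finite, a minimal blow-up datum of the axisymmetric class exists.
Known METHOD, not yet formalised (the unrestricted statement `rusin_sverak_minimal_blowup` is a
theorem of the tree). -/
def AxisymMinimalBlowupExists : Prop :=
  ∀ ν : ℝ, 0 < ν → axisymThreshold ν < ⊤ →
    ∃ (u₀ : EuclideanSpace ℝ (Fin 3) → EuclideanSpace ℝ (Fin 3))
      (g : FunctionSpaces.HomSobolev (EuclideanSpace ℝ (Fin 3)) (EuclideanSpace ℂ (Fin 3)) (1 / 2 : ℝ)),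
      IsAxisymMinimalBlowupDatum ν u₀ g

/-- **S2** (mirror extremality one level down — THE BET): if the axisymmetric minimal class is
nonempty, it contains a datum equivariant under the meridian mirror `σ (x₀,x₁,x₂) = (x₀,−x₁,x₂)`
(a `ℤ/2`-Smith fixed point on `M_ax / (scalings × axial translations)`). -/
def AxisymMinimalMirrorSymmetric : Prop :=
  ∀ ν : ℝ, 0 < ν →
    (∃ (u₀ : EuclideanSpace ℝ (Fin 3) → EuclideanSpace ℝ (Fin 3))
      (g : FunctionSpaces.HomSobolev (EuclideanSpace ℝ (Fin 3)) (EuclideanSpace ℂ (Fin 3)) (1 / 2 : ℝ)),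
      IsAxisymMinimalBlowupDatum ν u₀ g) →
    ∃ (u₀ : EuclideanSpace ℝ (Fin 3) → EuclideanSpace ℝ (Fin 3))
      (g : FunctionSpaces.HomSobolev (EuclideanSpace ℝ (Fin 3)) (EuclideanSpace ℂ (Fin 3)) (1 / 2 : ℝ)),
      IsAxisymMinimalBlowupDatum ν u₀ g ∧ ∀ x, u₀ (reflY x) = reflY (u₀ x)

/-- Mirror-symmetric axisymmetric minimal data do not exist (LANDED content only: `σ`-fixed
axisymmetric fields are swirl-free, and swirl-free axisymmetric `L³` data are Kato-global). -/
theorem not_isAxisymMinimal_of_mirror {ν : ℝ} (hν : 0 < ν)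
    {u₀ : EuclideanSpace ℝ (Fin 3) → EuclideanSpace ℝ (Fin 3)}
    {g : FunctionSpaces.HomSobolev (EuclideanSpace ℝ (Fin 3)) (EuclideanSpace ℂ (Fin 3)) (1 / 2 : ℝ)}
    (hmin : IsAxisymMinimalBlowupDatum ν u₀ g) (hσ : ∀ x, u₀ (reflY x) = reflY (u₀ x)) : False := by
  obtain ⟨hL3, -, hdiv, hax, -, hnot⟩ := hmin
  exact hnot (Theorems.AxisymmetricKatoGlobal.NoSwirlStratum.hasGlobalKatoSolution_of_isAxisymmetric_hasNoSwirl_viscosity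
    hν hL3 hdiv hax (hax.hasNoSwirl_of_reflY_eq hσ))

/-- **Composition of the attempted split**: S1 → S2 → crux (kernel-checked). -/
theorem crux_of_mirrorExtremality (h₁ : AxisymMinimalBlowupExists) (h₂ : AxisymMinimalMirrorSymmetric) :
    AxisymmetricKatoGlobal := by
  intro ν hν u₀ g hL3 hrep hdiv hax
  by_contra hnot
  have hax' : IsAxisymmetric u₀ := fun θ x => hax θ x
  have hfin : axisymThreshold ν < ⊤ :=
    lt_of_le_of_lt (axisymThreshold_le hL3 hrep hdiv hax' hnot) enorm_lt_top
  obtain ⟨u₂, g₂, hmin₂, hσ⟩ := h₂ ν hν (h₁ ν hν hfin)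
  exact not_isAxisymMinimal_of_mirror hν hmin₂ hσ

/-- **Costume certificate, part 1**: S2 is equivalent OVER THE TREE to emptiness of the
axisymmetric minimal class (the mirror acts freely on it). -/
theorem mirrorExtremality_iff_empty :
    AxisymMinimalMirrorSymmetric ↔
      ∀ ν : ℝ, 0 < ν → ¬ ∃ (u₀ : EuclideanSpace ℝ (Fin 3) → EuclideanSpace ℝ (Fin 3))
        (g : FunctionSpaces.HomSobolev (EuclideanSpace ℝ (Fin 3)) (EuclideanSpace ℂ (Fin 3)) (1 / 2 : ℝ)),
        IsAxisymMinimalBlowupDatum ν u₀ g := by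
  constructor
  · intro h ν hν hex
    obtain ⟨u₂, g₂, hmin₂, hσ⟩ := h ν hν hex
    exact not_isAxisymMinimal_of_mirror hν hmin₂ hσ
  · intro h ν hν hex
    exact absurd hex (h ν hν)

/-- The crux empties the axisymmetric minimal class (trivial direction). -/
theorem empty_of_crux (h : AxisymmetricKatoGlobal) :
    ∀ ν : ℝ, 0 < ν → ¬ ∃ (u₀ : EuclideanSpace ℝ (Fin 3) → EuclideanSpace ℝ (Fin 3))
      (g : FunctionSpaces.HomSobolev (EuclideanSpace ℝ (Fin 3)) (EuclideanSpace ℂ (Fin 3)) (1 / 2 : ℝ)),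
      IsAxisymMinimalBlowupDatum ν u₀ g := by
  rintro ν hν ⟨u₀, g, hL3, hrep, hdiv, hax, -, hnot⟩
  exact hnot (h ν hν u₀ g hL3 hrep hdiv (fun θ x => hax θ x))

/-- **Costume certificate, part 2**: over S1 (a known theorem's method), the bet S2 is
EQUIVALENT to the crux — the attempted split leaves the whole crux in one piece. -/
theorem mirrorExtremality_iff_crux (h₁ : AxisymMinimalBlowupExists) :
    AxisymMinimalMirrorSymmetric ↔ AxisymmetricKatoGlobal :=
  ⟨fun h₂ => crux_of_mirrorExtremality h₁ h₂,
    fun h => mirrorExtremality_iff_empty.2 (empty_of_crux h)⟩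

/-! ## §3 The parent lever pushed to 2-groups decides the summit without the crux — and is the summit -/

/-- Clay (A) fails at viscosity `ν` (the antecedent of `MinimalDatumPFold`, verbatim). -/
def ClayFailsAt (ν : ℝ) : Prop :=
  ∃ v₀ : EuclideanSpace ℝ (Fin 3) → EuclideanSpace ℝ (Fin 3), ContDiff ℝ (⊤ : ℕ∞) v₀ ∧
    NSWave0.IsDivFree v₀ ∧ HasRapidSpatialDecay v₀ ∧
    ¬ ∃ (u : ℝ → EuclideanSpace ℝ (Fin 3) → EuclideanSpace ℝ (Fin 3)) (p : ℝ → EuclideanSpace ℝ (Fin 3) → ℝ),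
      IsSmoothOnHalfSpace u ∧ IsSmoothOnHalfSpace p ∧ IsNavierStokesSolution ν 0 v₀ u p ∧ HasBoundedEnergy u

/-- **The `F₂`-Smith output**: if Clay (A) fails at `ν`, then for unboundedly many `p` there is a
minimal blow-up datum equivariant under the dihedral group `⟨R_{2π/p}, σ⟩` (for `p = 2^k` a
2-group, so P. A. Smith's theorem applies under `F₂`-acyclicity of `M̂`). -/
def MinimalDatumDihedral : Prop :=
  ∀ ν : ℝ, 0 < ν → ClayFailsAt ν → ∀ N : ℕ, ∃ p : ℕ, N ≤ p ∧ 2 ≤ p ∧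
    ∃ (u₀ : EuclideanSpace ℝ (Fin 3) → EuclideanSpace ℝ (Fin 3))
      (g : FunctionSpaces.HomSobolev (EuclideanSpace ℝ (Fin 3)) (EuclideanSpace ℂ (Fin 3)) (1 / 2 : ℝ)),
      IsMinimalBlowupDatum ν u₀ g ∧
      (∀ x, u₀ (rotZ (2 * Real.pi / p) x) = rotZ (2 * Real.pi / p) (u₀ x)) ∧
      ∀ x, u₀ (reflY x) = reflY (u₀ x)

/-- **Compactness upgrade carrying the mirror** (the analogue of the LANDED `PFoldToAxisymmetric`:
modulate by scalings/translations, pin the axes, close the dense angle subgroup, keep the closed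
condition of `σ`-equivariance, upgrade a.e. to everywhere). -/
def DihedralToMirrorAxisymmetric : Prop :=
  ∀ ν : ℝ, 0 < ν →
    (∀ N : ℕ, ∃ p : ℕ, N ≤ p ∧ 2 ≤ p ∧
      ∃ (u₀ : EuclideanSpace ℝ (Fin 3) → EuclideanSpace ℝ (Fin 3))
        (g : FunctionSpaces.HomSobolev (EuclideanSpace ℝ (Fin 3)) (EuclideanSpace ℂ (Fin 3)) (1 / 2 : ℝ)),
        IsMinimalBlowupDatum ν u₀ g ∧
        (∀ x, u₀ (rotZ (2 * Real.pi / p) x) = rotZ (2 * Real.pi / p) (u₀ x)) ∧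
        ∀ x, u₀ (reflY x) = reflY (u₀ x)) →
    ∃ (u₀ : EuclideanSpace ℝ (Fin 3) → EuclideanSpace ℝ (Fin 3))
      (g : FunctionSpaces.HomSobolev (EuclideanSpace ℝ (Fin 3)) (EuclideanSpace ℂ (Fin 3)) (1 / 2 : ℝ)),
      IsMinimalBlowupDatum ν u₀ g ∧ IsAxisymmetric u₀ ∧ ∀ x, u₀ (reflY x) = reflY (u₀ x)

/-- **The 2-group route decides the summit WITHOUT `AxisymmetricKatoGlobal`.** -/
theorem closes_dihedral (h₂ : MinimalDatumDihedral) (h₄ : DihedralToMirrorAxisymmetric) :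
    NavierStokesRegularity := by
  show Literature.NS.NavierStokesExistenceSmoothR3
  intro ν hν u₀ hsm hdiv hdec
  by_contra hno
  obtain ⟨u₁, g, hmin, hax, hσ⟩ := h₄ ν hν (h₂ ν hν ⟨u₀, hsm, hdiv, hdec, hno⟩)
  obtain ⟨hL3, -, hdiv₁, -, hnot⟩ := hmin
  exact hnot (Theorems.AxisymmetricKatoGlobal.NoSwirlStratum.hasGlobalKatoSolution_of_isAxisymmetric_hasNoSwirl_viscosity
    hν hL3 hdiv₁ hax (hax.hasNoSwirl_of_reflY_eq hσ))

/-- **… and its one open crux IS the summit** (over the provable compactness upgrade): asking the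
Smith lever for any symmetry containing a meridian mirror yields a restatement of Clay (A). -/
theorem minimalDatumDihedral_iff_summit (h₄ : DihedralToMirrorAxisymmetric) :
    MinimalDatumDihedral ↔ NavierStokesRegularity := by
  refine ⟨fun h₂ => closes_dihedral h₂ h₄, fun hS => ?_⟩
  intro ν hν hfail
  obtain ⟨v₀, hsm, hdiv, hdec, hno⟩ := hfail
  exact absurd (hS ν hν v₀ hsm hdiv hdec) hno

end Summit.NavierStokesRegularity.NavierStokesRegularity.Cruxes.AxisymmetricKatoGlobal.StrategistS12g7

end
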